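import Summits.ResolutionOfSingularities.ResolutionOfSingularities.Theorems.FrobeniusLadderFInjectiveMacaulayficationCIChartCore
import Mathlib.RingTheory.KrullDimension.Regular
import HarnessLib

/-!
# CI chart presentation (C1ᶜⁱ), part 4: expected-dimension bookkeeping — the orbit form implies the chart form
# (crux `FInjectiveMacaulayfication`, CI-CN engine kernel, CRUX-PLAN w45a v9 piece C1ᶜⁱ; seat res-L1-w45a-stub-1)

[OURS · L1 W4.5a] Support file for crux stmt-ResolutionOfSingularities-15315. AI-written, weaker than expert review; no statement of
[claim: Hironaka2017] is used. The CI-CN engine meets TWO «expected dimension» binders at a chart point `Q̃` of the toric chart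
(`S = k[Y]_Q̃` regular local, `gs` = the `r` chart strict transforms, `ys` = the orbit coordinates `Yᵢ ∈ Q̃`):
* the ORBIT form `dim S⧸(gs ++ ys) + |gs| + |ys| = dim S` (idea-1 §8 `ciChartCore`; tri-1 F17) — the hypothesis under which
  `CIChartPresentationLocal.isSMulRegular_algebraMap_X_of_expectedDim` identifies the local ring of the strict transform with `S ⧸ (gs)`;
* the CHART form `dim S⧸(gs) + |gs| = dim S` — the `hdim` of res-L1-w45a-stub-6's `CIChartClause.ciChartClause` /
  `CIFedderAtMaximalIdeal.ci_fedderAtMaximalIdeal` (after `(k[Y]⧸(g))_Q ≅ S ⧸ (gs)`).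
This file proves ORBIT ⇒ CHART, so the G5ᶜⁱ glue quantifies the orbit form only:
* `ringKrullDim_quotient_ofList_add_length` — in a Noetherian local ring, the quotient by a WEAKLY REGULAR sequence `L ⊆ 𝔪` has
  dimension `dim S − |L|` (induction on `L` over Mathlib's `ringKrullDim_quotient_span_singleton_succ_eq_ringKrullDim`);
* `expectedDim_of_expectedDim_append` — in a regular local ring, the orbit form for `gs ++ ys` implies the chart form for `gs`
  (`gs ++ ys` is weakly regular by `CIChartCore.isWeaklyRegular_of_ringKrullDim_quotient`, hence so is `gs`).
(The converse fails: `(g₁, g₂) = (Y₁ + Y₂h, Y₂)` has the chart form at the origin but contains `Y₁`.) No definition is declared. [folklore]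
-/

set_option linter.dupNamespace false

namespace Summit.ResolutionOfSingularities.ResolutionOfSingularities.Theorems.FInjectiveMacaulayfication.CIExpectedDim

open IsLocalRing RingTheory.Sequence Literature.AlgebraicGeometry.Resolution
  Summit.ResolutionOfSingularities.ResolutionOfSingularities.Theorems.FInjectiveMacaulayfication

/-- **The quotient by a weakly regular sequence in `𝔪` has dimension `dim S − |L|`** (Noetherian local `S`): induction on the
length, cutting down by the first member (`ringKrullDim_quotient_span_singleton_succ_eq_ringKrullDim`) and passing to the local ring
`S ⧸ (x)`, with `(S⧸(x)) ⧸ (L) ≅ S ⧸ (x :: L)`. [folklore; Matsumura 17.4] -/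
theorem ringKrullDim_quotient_ofList_add_length : ∀ (n : ℕ) (S : Type) [CommRing S] [IsNoetherianRing S] [IsLocalRing S]
    (L : List S), L.length = n → (∀ x ∈ L, x ∈ maximalIdeal S) → IsWeaklyRegular S L →
    ringKrullDim (S ⧸ Ideal.ofList L) + (n : WithBot ℕ∞) = ringKrullDim S := by
  intro n
  induction n with
  | zero =>
    intro S _ _ _ L hlen _ _
    rw [List.length_eq_zero_iff] at hlen
    subst hlen
    rw [Nat.cast_zero, add_zero,
      ringKrullDim_eq_of_ringEquiv ((Ideal.quotEquivOfEq (Ideal.ofList_nil (R := S))).trans (RingEquiv.quotientBot S))]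
  | succ n ih =>
    intro S _ _ _ L hlen hL hw
    obtain ⟨x, L', rfl⟩ : ∃ x L', L = x :: L' := by
      cases L with
      | nil => simp at hlen
      | cons x L' => exact ⟨x, L', rfl⟩
    have hlen' : L'.length = n := by simpa using hlen
    have hx𝔪 : x ∈ maximalIdeal S := hL x (by simp)
    have hL' : ∀ y ∈ L', y ∈ maximalIdeal S := fun y hy => hL y (by simp [hy])
    -- `x` is regular and `L'` is weakly regular on `S ⧸ (x)`
    have hw' : IsWeaklyRegular S ([x] ++ L') := hw
    obtain ⟨hwx, hwL'⟩ := (isWeaklyRegular_append_iff S [x] L').mp hw'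
    have hxreg : IsSMulRegular S x := ((isWeaklyRegular_cons_iff S x []).mp hwx).1
    set S₁ := S ⧸ Ideal.ofList [x] with hS₁
    set mk := Ideal.Quotient.mk (Ideal.ofList [x]) with hmk
    have hwq : IsWeaklyRegular S₁ (L'.map mk) := CIChartCore.isWeaklyRegular_quotient_of_quotient_smul_top _ _ hwL'
    obtain ⟨-, hnt, hloc⟩ := CIChartCore.isLocalRing_quotient_ofList [x] (fun y hy => by
      rw [List.mem_singleton] at hy; subst hy; exact hx𝔪)
    have hmaxq : (maximalIdeal S).map mk = maximalIdeal S₁ := map_maximalIdeal_of_surjective mk Ideal.Quotient.mk_surjective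
    have hL'q : ∀ z ∈ L'.map mk, z ∈ maximalIdeal S₁ := by
      intro z hz
      obtain ⟨y, hy, rfl⟩ := List.mem_map.mp hz
      rw [← hmaxq]
      exact Ideal.mem_map_of_mem mk (hL' y hy)
    -- induction hypothesis in `S₁`
    have hIH := ih S₁ (L'.map mk) (by rw [List.length_map, hlen']) hL'q hwq
    -- `dim S₁ + 1 = dim S`
    have hdrop : ringKrullDim S₁ + 1 = ringKrullDim S := by
      change ringKrullDim (S ⧸ Ideal.ofList [x]) + 1 = ringKrullDim S
      rw [ringKrullDim_eq_of_ringEquiv (Ideal.quotEquivOfEq (Ideal.ofList_singleton x))]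
      exact ringKrullDim_quotient_span_singleton_succ_eq_ringKrullDim hxreg hx𝔪
    -- `S₁ ⧸ (L') ≅ S ⧸ (x :: L')`
    have e : (S₁ ⧸ Ideal.ofList (L'.map mk)) ≃+* S ⧸ Ideal.ofList (x :: L') :=
      ((Ideal.quotEquivOfEq (Ideal.map_ofList mk L').symm).trans
        (DoubleQuot.quotQuotEquivQuotSup (Ideal.ofList [x]) (Ideal.ofList L'))).trans
        (Ideal.quotEquivOfEq (Ideal.ofList_append [x] L').symm)
    rw [← ringKrullDim_eq_of_ringEquiv e, Nat.cast_succ, ← add_assoc, hIH, hdrop]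

/-- **Expected dimension: the ORBIT form implies the CHART form.** In a regular local ring `S`, if `gs, ys ⊆ 𝔪` and
`dim S⧸(gs ++ ys) + |gs| + |ys| = dim S`, then `dim S⧸(gs) + |gs| = dim S` (`gs ++ ys` is weakly regular by
`CIChartCore.isWeaklyRegular_of_ringKrullDim_quotient`, hence so is `gs`, and `ringKrullDim_quotient_ofList_add_length` applies).
[folklore] -/
theorem expectedDim_of_expectedDim_append {S : Type} [CommRing S] [IsRegularLocalRing S] (gs ys : List S)
    (hgs : ∀ g ∈ gs, g ∈ maximalIdeal S) (hys : ∀ y ∈ ys, y ∈ maximalIdeal S)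
    (hdim : ringKrullDim (S ⧸ Ideal.ofList (gs ++ ys)) + ((gs.length + ys.length : ℕ) : WithBot ℕ∞) = ringKrullDim S) :
    ringKrullDim (S ⧸ Ideal.ofList gs) + (gs.length : WithBot ℕ∞) = ringKrullDim S := by
  set L := gs ++ ys with hL_def
  have hL : ∀ x ∈ L, x ∈ maximalIdeal S := by
    intro x hx
    rcases List.mem_append.mp hx with hx | hx
    · exact hgs x hx
    · exact hys x hx
  obtain ⟨-, hnt, hloc⟩ := CIChartCore.isLocalRing_quotient_ofList L hL
  obtain ⟨e, he⟩ := exists_nat_cast_eq_ringKrullDim (R := S ⧸ Ideal.ofList L)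
  have hdimS : ringKrullDim S = ((L.length + e : ℕ) : WithBot ℕ∞) := by
    rw [← hdim, he, hL_def, List.length_append]
    push_cast
    ring
  have hw : IsWeaklyRegular S L := CIChartCore.isWeaklyRegular_of_ringKrullDim_quotient L hL e hdimS he
  have hw₁ : IsWeaklyRegular S gs := ((isWeaklyRegular_append_iff S gs ys).mp hw).1
  exact ringKrullDim_quotient_ofList_add_length gs.length S gs rfl hgs hw₁

end Summit.ResolutionOfSingularities.ResolutionOfSingularities.Theorems.FInjectiveMacaulayfication.CIExpectedDim
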